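import Mathlib.Analysis.Calculus.FDeriv.Mul
import Mathlib.Analysis.Calculus.ContDiff.Defs
import Mathlib.Algebra.Star.Unitary
import Mathlib.Analysis.InnerProductSpace.PiL2
import Mathlib.Analysis.Matrix.Normed
import Mathlib.Analysis.Normed.Operator.Mul
import Mathlib.Analysis.Complex.Basic
import Mathlib.LinearAlgebra.UnitaryGroup
import Mathlib.MeasureTheory.Integral.Bochner.Basic
import Mathlib.MeasureTheory.Measure.Haar.OfBasis
import HarnessLib

-- provenance: harness21/H21/H21/Prelude/QLatticeAQFT/YangMillsClassical.lean @ 95ee30e (interim HEAD d8f2665); M5 mechanical rewrite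
/-!
# Classical Yang–Mills theory on flat space (trivial bundle)

Trunk: `QLatticeAQFT`, item G13 (`ym_classical_connection`).

We set up the classical (Euclidean) Yang–Mills functional on a finite-dimensional real inner
product space `E` (flat space `ℝᵈ`) for the trivial principal bundle, so that a connection is a
globally defined Lie-algebra-valued one-form `A : E → (E →L[ℝ] 𝔸)`.

* `Literature.AQFT.Connection E 𝔸`: `𝔸`-valued one-forms `x ↦ (v ↦ A x v)`.
* `Literature.AQFT.curvature A x u v = ∂ᵤ(A · v)(x) − ∂ᵥ(A · u)(x) + ⁅A x u, A x v⁆`, the curvature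
  two-form `F_A = dA + A ∧ A` evaluated on constant vectors `u v`.
* `Literature.AQFT.covDeriv A φ x u = ∂ᵤ φ (x) + ⁅A x u, φ x⁆`, the covariant derivative of an
  adjoint-valued function.
* `Literature.AQFT.ymDensity A x = ∑_{i<j} ‖F_A(x)(eᵢ, eⱼ)‖²` in the orthonormal frame
  `stdOrthonormalBasis ℝ E`, `Literature.AQFT.ymAction A = ∫ ymDensity A`, `Literature.MathematicalPhysics.QuantumLattice.HasFiniteAction`.
* `Literature.AQFT.IsYangMillsConnection A`: the Yang–Mills equation `D_A^* F_A = 0`, i.e.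
  `∑ᵢ D_{eᵢ} F_A(eᵢ, v) = 0` for all `v`.
* `Literature.MathematicalPhysics.QuantumLattice.IsFlat`, `Literature.MathematicalPhysics.QuantumLattice.IsSmoothConnection`, the Bianchi identity
  `Literature.MathematicalPhysics.QuantumLattice.covDeriv_curvature_cyclic`.
* Gauge transformations `g : E → 𝔸ˣ`: `Literature.AQFT.gaugeAct g A = g A g⁻¹ − (dg) g⁻¹`,
  `Literature.AQFT.pureGauge g = gaugeAct g 0`, `Literature.MathematicalPhysics.QuantumLattice.curvature_gaugeAct` (`F ↦ g F g⁻¹`),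
  `Literature.MathematicalPhysics.QuantumLattice.isFlat_pureGauge`, `Literature.MathematicalPhysics.QuantumLattice.ymAction_gaugeAct` (for `g` acting isometrically by
  conjugation), and the unitary matrix case `Literature.MathematicalPhysics.QuantumLattice.ymAction_gaugeAct_unitaryGroup`
  (`𝔸 = Matrix (Fin N) (Fin N) ℂ` with the Frobenius = Hilbert–Schmidt norm).

## Mathlib anchors and design choices

* **The coefficient algebra.** The outline asks for an abstract real normed Lie algebra
  `[NormedAddCommGroup 𝔤] [NormedSpace ℝ 𝔤] [LieRing 𝔤] [LieAlgebra ℝ 𝔤]`. In Mathlib this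
  combination is an instance *diamond* (`LieRing` extends `AddCommGroup`, `LieAlgebra` extends
  `Module`; the `overlappingInstances` linter rejects it) and Mathlib has no `NormedLieRing`
  class. We therefore take, as in the physics literature (compact `G ⊆ U(N)`), a real normed
  associative algebra `𝔸` (`[NormedRing 𝔸] [NormedAlgebra ℝ 𝔸]`) and use Mathlib's *global*
  commutator bracket `Ring.instBracket : ⁅a, b⁆ = a * b - b * a` (`Ring.lie_def`). Every
  finite-dimensional real Lie algebra embeds in such an `𝔸` (Ado), and for gauge theory
  `𝔸 = Matrix (Fin N) (Fin N) ℂ ⊇ 𝔲(N) ⊇ 𝔤`; the constraint "`A` is `𝔤`-valued" is the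
  predicate `Literature.MathematicalPhysics.QuantumLattice.Connection.IsValuedIn`. This also makes gauge transformations `g : E → 𝔸ˣ`
  available in full generality (the outline's matrix formula `g A g⁻¹ − (dg) g⁻¹` verbatim).
* Mathlib has `extDeriv` (`Mathlib/Analysis/Calculus/DifferentialForm/Basic.lean`) but only for
  maps valued in continuous *alternating* forms `E [⋀^Fin n]→L[ℝ] F`; the non-abelian term
  `A ∧ A` has no Mathlib counterpart. We therefore work directly with `fderiv`; the dictionary
  is `dA (x)(u, v) = fderiv ℝ (A · v) x u − fderiv ℝ (A · u) x v`.
* Smoothness uses `ContDiff ℝ ∞` (`∞ = ((⊤ : ℕ∞) : WithTop ℕ∞)`, *not* `ω`).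
* All declarations live in `namespace Literature.AQFT` (outline §0), except the pure matrix fact
  `Matrix.frobenius_norm_toUnits_mul_mul_inv`, a deliberate dot-notation extension of Mathlib's
  `Matrix` namespace (Mathlib has `Matrix.frobenius_norm_conjTranspose`, `Matrix.frobenius_norm_mul`
  but no unitary invariance of the Frobenius norm).
* Junk values: `curvature`, `covDeriv`, `gaugeAct` use `fderiv`, which is `0` at points of
  non-differentiability; the predicates `IsFlat`, `IsYangMillsConnection` and the connection
  `pureGauge g` are therefore only meaningful for smooth data and should be paired with
  `IsSmoothConnection` / `ContDiff` hypotheses in statements.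
* The gauge-covariance lemmas assume `[HasSummableGeomSeries 𝔸]` (implied by `CompleteSpace 𝔸`,
  hence by finite dimension) so that Mathlib's `hasFDerivAt_ringInverse` /
  `differentiableAt_inverse` (`Mathlib/Analysis/Calculus/FDeriv/Mul.lean`) apply to
  `y ↦ (g y)⁻¹`.
* Basis independence of the density (`Literature.MathematicalPhysics.QuantumLattice.ymDensity_eq_of_orthonormalBasis`) needs (a) the
  norm on `𝔸` to come from an inner product (it is false for a general norm once
  `finrank ℝ E ≥ 3`) and (b) differentiability of `A` at the point (otherwise the junk values of
  `fderiv` make `curvature A x` non-bilinear and the density frame dependent); it is stated for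
  the Frobenius norm on complex matrices under `DifferentiableAt ℝ A x`.
* The Bianchi identity and gauge covariance of the curvature are second-order statements and are
  stated under `ContDiff ℝ 2` hypotheses.
* For matrices Mathlib deliberately provides no global norm instance; in the matrix section we
  use the Frobenius (Hilbert–Schmidt) norm via `open scoped Matrix.Norms.Frobenius`
  (`Matrix.frobeniusNormedRing`, `Matrix.frobeniusNormedAlgebra`), which is the `Ad U(N)`-invariant
  one, so that `ymDensity A x = ∑_{i<j} tr (F_{ij}(x)† F_{ij}(x))`. Downstream files using the
  matrix declarations must open the same scope, and must NOT mix it with the outline's default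
  `Matrix.Norms.L2Operator` scope inside one section (two norm instances on `Matrix`).
* `volume` on `E` is Mathlib's `measureSpaceOfInnerProductSpace` (Lebesgue measure).

## References

* A. Jaffe, E. Witten, *Quantum Yang–Mills theory* (Clay Millennium problem description, 2000),
  §1.
* S. K. Donaldson, P. B. Kronheimer, *The Geometry of Four-Manifolds* (OUP 1990), §2.1.
-/

noncomputable section

open scoped ContDiff
open MeasureTheory Module

namespace Literature.MathematicalPhysics.QuantumLattice

/-! ### Connections, curvature, covariant derivative -/

section General

variable {E : Type*} [NormedAddCommGroup E] [InnerProductSpace ℝ E]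
variable {𝔸 : Type*} [NormedRing 𝔸] [NormedAlgebra ℝ 𝔸]

variable (E 𝔸) in
/-- A connection on the trivial principal bundle over flat space `E` with coefficients in the
real normed algebra `𝔸` (Lie bracket = commutator): an `𝔸`-valued one-form, i.e. a map
assigning to each point `x : E` a continuous linear map `E →L[ℝ] 𝔸` (`v ↦ A_v(x)`).
Jaffe–Witten (2000) §1; Donaldson–Kronheimer §2.1. [cite: JaffeWitten2000] -/
abbrev Connection : Type _ := E → E →L[ℝ] 𝔸

/-- A connection `A` takes values in the subspace `𝔤 ⊆ 𝔸` (typically a Lie subalgebra such as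
`𝔰𝔲(N) ⊆ M_N(ℂ)`; the intended instance `𝔲(N)` is Mathlib's `skewAdjoint.submodule ℝ (Matrix …)`)
if `A x v ∈ 𝔤` for all `x v`.
Jaffe–Witten (2000) §1 (`𝔤`-valued one-forms). [cite: JaffeWitten2000] -/
def Connection.IsValuedIn (𝔤 : Submodule ℝ 𝔸) (A : Connection E 𝔸) : Prop :=
  ∀ x v : E, A x v ∈ 𝔤

/-- The curvature two-form of a connection `A` at `x`, evaluated on constant vectors `u v`:
`F_A(x)(u,v) = ∂ᵤ A_v(x) − ∂ᵥ A_u(x) + [A_u(x), A_v(x)]` (i.e. `F_A = dA + A ∧ A`), where the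
bracket is the commutator in `𝔸`.
Junk value: if `A` is not differentiable at `x`, `fderiv` is `0` and only the bracket survives.
Jaffe–Witten (2000) §1; Donaldson–Kronheimer (2.1.4). [cite: JaffeWitten2000] -/
def curvature (A : Connection E 𝔸) (x u v : E) : 𝔸 :=
  fderiv ℝ (fun y => A y v) x u - fderiv ℝ (fun y => A y u) x v + ⁅A x u, A x v⁆

/-- The curvature is antisymmetric: `F_A(x)(u,v) = −F_A(x)(v,u)` (name fixed by the outline, cf.
`LinearMap.BilinForm.IsAlt.neg_eq`). Donaldson–Kronheimer §2.1. [folklore] -/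
theorem curvature_antisymm (A : Connection E 𝔸) (x u v : E) :
    curvature A x u v = -curvature A x v u := by
  simp only [curvature, Ring.lie_def]
  abel

/-- The curvature vanishes on the diagonal: `F_A(x)(u,u) = 0`. Donaldson–Kronheimer §2.1. [folklore] -/
@[simp]
theorem curvature_self (A : Connection E 𝔸) (x u : E) : curvature A x u u = 0 := by
  simp [curvature, Ring.lie_def]

/-- A connection is smooth if `x ↦ A x` is `C^∞` as a map `E → (E →L[ℝ] 𝔸)`.
Jaffe–Witten (2000) §1. [cite: JaffeWitten2000] -/
def IsSmoothConnection (A : Connection E 𝔸) : Prop :=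
  ContDiff ℝ ∞ A

/-- A connection is flat if its curvature vanishes identically, `F_A = 0`. Meaningful for smooth
`A` only (junk `fderiv = 0` otherwise); pair with `IsSmoothConnection` in statements.
Donaldson–Kronheimer §2.2.1. [folklore] -/
def IsFlat (A : Connection E 𝔸) : Prop :=
  ∀ x u v : E, curvature A x u v = 0

/-- The covariant derivative of an `𝔸`-valued (adjoint) function `φ` along the constant vector
`u` at `x`: `(D_A φ)(x)(u) = ∂ᵤ φ(x) + [A_u(x), φ(x)]`. Donaldson–Kronheimer (2.1.11). [folklore] -/
def covDeriv (A : Connection E 𝔸) (φ : E → 𝔸) (x u : E) : 𝔸 :=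
  fderiv ℝ φ x u + ⁅A x u, φ x⁆

/-- The zero connection (product connection) is flat. Donaldson–Kronheimer §2.1. [folklore] -/
theorem isFlat_zero : IsFlat (0 : Connection E 𝔸) := by
  intro x u v
  simp [curvature, Ring.lie_def]

/-- **Bianchi identity** `D_A F_A = 0` on flat space, evaluated on constant vectors `u v w`:
`D_u F(v,w) + D_v F(w,u) + D_w F(u,v) = 0` for a `C²` connection (in particular for
`IsSmoothConnection A`). Donaldson–Kronheimer (2.1.21); Jaffe–Witten (2000) §1. [cite: JaffeWitten2000] -/
def covDeriv_curvature_cyclic : Prop :=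
  ∀ (A : Connection E 𝔸) (hA : ContDiff ℝ 2 A) (x u v w : E),
    covDeriv A (fun y => curvature A y v w) x u + covDeriv A (fun y => curvature A y w u) x v +
      covDeriv A (fun y => curvature A y u v) x w = 0

/-! ### Gauge transformations -/

/-- The action of a gauge transformation `g : E → 𝔸ˣ` on a connection:
`(g • A)(x)(v) = g(x) A_v(x) g(x)⁻¹ − (∂ᵥ g)(x) g(x)⁻¹`, built as a continuous linear map in `v`
from `ContinuousLinearMap.mulLeftRight`. Junk value: if `g` is not differentiable at `x` the
inhomogeneous term is `0`. Jaffe–Witten (2000) §1; Donaldson–Kronheimer (2.1.7). [cite: JaffeWitten2000] -/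
def gaugeAct (g : E → 𝔸ˣ) (A : Connection E 𝔸) : Connection E 𝔸 := fun x =>
  (ContinuousLinearMap.mulLeftRight ℝ 𝔸 (g x : 𝔸) ((g x)⁻¹ : 𝔸ˣ)).comp (A x) -
    (ContinuousLinearMap.mulLeftRight ℝ 𝔸 1 ((g x)⁻¹ : 𝔸ˣ)).comp
      (fderiv ℝ (fun y => (g y : 𝔸)) x)

/-- Pointwise formula `(g • A)(x)(v) = g A_v g⁻¹ − (∂ᵥ g) g⁻¹`. Donaldson–Kronheimer (2.1.7). [folklore] -/
@[simp]
theorem gaugeAct_apply (g : E → 𝔸ˣ) (A : Connection E 𝔸) (x v : E) :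
    gaugeAct g A x v =
      (g x : 𝔸) * A x v * ((g x)⁻¹ : 𝔸ˣ) - fderiv ℝ (fun y => (g y : 𝔸)) x v * ((g x)⁻¹ : 𝔸ˣ) := by
  simp [gaugeAct]

/-- The pure-gauge connection `g • 0 = −(dg) g⁻¹` obtained from the product connection by the
gauge transformation `g`. Meaningful for differentiable `g` only (junk `fderiv = 0` otherwise);
pair with a `ContDiff` hypothesis on `g` in statements. Donaldson–Kronheimer §2.2.1. [folklore] -/
def pureGauge (g : E → 𝔸ˣ) : Connection E 𝔸 :=
  gaugeAct g 0

/-- Pointwise formula for the pure-gauge connection, `−(∂ᵥ g) g⁻¹`.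
Donaldson–Kronheimer §2.2.1. [folklore] -/
@[simp]
theorem pureGauge_apply (g : E → 𝔸ˣ) (x v : E) :
    pureGauge g x v = -(fderiv ℝ (fun y => (g y : 𝔸)) x v * ((g x)⁻¹ : 𝔸ˣ)) := by
  simp [pureGauge]

section GaugeCovariance

variable [HasSummableGeomSeries 𝔸]

/-- Curvature transforms in the adjoint representation under gauge transformations:
`F_{g • A}(x)(u,v) = g(x) F_A(x)(u,v) g(x)⁻¹` for `C²` gauge transformations and differentiable
connections. `[HasSummableGeomSeries 𝔸]` makes Mathlib's `hasFDerivAt_ringInverse` available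
for `y ↦ (g y)⁻¹`. Jaffe–Witten (2000) §1; Donaldson–Kronheimer (2.1.8). [cite: JaffeWitten2000] -/
def curvature_gaugeAct : Prop :=
  ∀ (g : E → 𝔸ˣ) (A : Connection E 𝔸) (hg : ContDiff ℝ 2 fun y => (g y : 𝔸)) (hA : Differentiable ℝ A) (x u v : E),
    curvature (gaugeAct g A) x u v = (g x : 𝔸) * curvature A x u v * ((g x)⁻¹ : 𝔸ˣ)

/-- Pure-gauge connections are flat (`C²` gauge transformations).
Donaldson–Kronheimer §2.2.1. [folklore] -/
def isFlat_pureGauge : Prop :=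
  ∀ (g : E → 𝔸ˣ) (hg : ContDiff ℝ 2 fun y => (g y : 𝔸)),
    IsFlat (pureGauge g)

/- interim proof relied on results that are now named facts (D-0014); demoted to a fact by the M5 import, proof preserved:
:= by
  intro x u v
  have h := curvature_gaugeAct g 0 hg (differentiable_const _) x u v
  simpa [pureGauge, isFlat_zero x u v] using h
-/

/-- The curvature of a pure-gauge connection vanishes: `F_{−(dg)g⁻¹} = 0`
(`C²` gauge transformations). Donaldson–Kronheimer §2.2.1. [folklore] -/
def curvature_pureGauge : Prop :=
  ∀ (g : E → 𝔸ˣ) (hg : ContDiff ℝ 2 fun y => (g y : 𝔸)) (x u v : E),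
    curvature (pureGauge g) x u v = 0

/- interim proof relied on results that are now named facts (D-0014); demoted to a fact by the M5 import, proof preserved:
:=
  isFlat_pureGauge g hg x u v
-/

end GaugeCovariance

/-! ### The Yang–Mills density, action and equation -/

variable [FiniteDimensional ℝ E]

/-- The Yang–Mills Lagrangian density of `A` at `x` computed in an orthonormal frame `b`
indexed by a linearly ordered finite type: `∑_{i<j} ‖F_A(x)(bᵢ, bⱼ)‖²`.
Jaffe–Witten (2000) §1, `‖F‖²`. [cite: JaffeWitten2000] -/
def ymDensityOfBasis {ι : Type*} [Fintype ι] [LinearOrder ι] (b : OrthonormalBasis ι ℝ E)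
    (A : Connection E 𝔸) (x : E) : ℝ :=
  ∑ i, ∑ j, if i < j then ‖curvature A x (b i) (b j)‖ ^ 2 else 0

/-- The Yang–Mills Lagrangian density `|F_A(x)|² = ∑_{i<j} ‖F_A(x)(eᵢ, eⱼ)‖²` in the standard
orthonormal frame `e = stdOrthonormalBasis ℝ E`. Jaffe–Witten (2000) §1. [cite: JaffeWitten2000] -/
def ymDensity (A : Connection E 𝔸) (x : E) : ℝ :=
  ymDensityOfBasis (stdOrthonormalBasis ℝ E) A x

omit [FiniteDimensional ℝ E] in
/-- The Yang–Mills density in any frame is nonnegative. Jaffe–Witten (2000) §1. [cite: JaffeWitten2000] -/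
theorem ymDensityOfBasis_nonneg {ι : Type*} [Fintype ι] [LinearOrder ι]
    (b : OrthonormalBasis ι ℝ E) (A : Connection E 𝔸) (x : E) : 0 ≤ ymDensityOfBasis b A x := by
  unfold ymDensityOfBasis
  refine Finset.sum_nonneg fun i _ => Finset.sum_nonneg fun j _ => ?_
  split_ifs <;> positivity

/-- The Yang–Mills density is nonnegative. Jaffe–Witten (2000) §1. [cite: JaffeWitten2000] -/
theorem ymDensity_nonneg (A : Connection E 𝔸) (x : E) : 0 ≤ ymDensity A x :=
  ymDensityOfBasis_nonneg _ A x

/-- The (Euclidean) Yang–Mills equation `D_A^* F_A = 0` on flat space: for every point `x` and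
direction `v`, `∑ᵢ D_{eᵢ} (F_A(eᵢ, v))(x) = 0` in the standard orthonormal frame
`e = stdOrthonormalBasis ℝ E`. These are the Euler–Lagrange equations of `ymAction`
(for a conjugation-invariant inner-product norm on `𝔸`). Meaningful for smooth `A` only (junk
`fderiv = 0` otherwise, and the predicate degenerates to an algebraic identity); pair with
`IsSmoothConnection` in statements.
Jaffe–Witten (2000) §1 (`0 = d_A * F`); Donaldson–Kronheimer (2.1.29). [cite: JaffeWitten2000] -/
def IsYangMillsConnection (A : Connection E 𝔸) : Prop :=
  ∀ x v : E, ∑ i, covDeriv A (fun y => curvature A y (stdOrthonormalBasis ℝ E i) v) x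
    (stdOrthonormalBasis ℝ E i) = 0

/-- Flat connections satisfy the Yang–Mills equation. Donaldson–Kronheimer §2.1. [folklore] -/
theorem IsFlat.isYangMillsConnection {A : Connection E 𝔸} (hA : IsFlat A) :
    IsYangMillsConnection A := by
  intro x v
  simp [covDeriv, hA _ _ _, Ring.lie_def]

/-- The Yang–Mills density is gauge invariant when `g` acts isometrically by conjugation
(e.g. unitary-valued `g` for a unitarily invariant norm). Jaffe–Witten (2000) §1. [cite: JaffeWitten2000] -/
def ymDensity_gaugeAct : Prop :=
  ∀ [HasSummableGeomSeries 𝔸] (g : E → 𝔸ˣ) (A : Connection E 𝔸) (hg : ContDiff ℝ 2 fun y => (g y : 𝔸)) (hA : Differentiable ℝ A) (hiso : ∀ (x : E) (a : 𝔸), ‖(g x : 𝔸) * a * ((g x)⁻¹ : 𝔸ˣ)‖ = ‖a‖) (x : E),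
    ymDensity (gaugeAct g A) x = ymDensity A x

/- interim proof relied on results that are now named facts (D-0014); demoted to a fact by the M5 import, proof preserved:
:= by
  simp [ymDensity, ymDensityOfBasis, curvature_gaugeAct g A hg hA, hiso]
-/

variable [MeasurableSpace E] [BorelSpace E]

/-- The (Euclidean) Yang–Mills action `S(A) = ∫_E |F_A(x)|² dx` (we omit the conventional
factor `1/(2g²)`), with respect to Lebesgue measure `volume` on `E`.
Junk value: `0` if the density is not integrable. Jaffe–Witten (2000) §1, eq. for `S`. [cite: JaffeWitten2000] -/
def ymAction (A : Connection E 𝔸) : ℝ :=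
  ∫ x, ymDensity A x

/-- A connection has finite action if its Yang–Mills density is integrable on `E`
(Mathlib's `Integrable`, which besides `∫ |F_A|² < ∞` also demands a.e.-strong measurability of
the density; this is automatic for continuous, in particular smooth, `A`).
Jaffe–Witten (2000) §1. [cite: JaffeWitten2000] -/
def HasFiniteAction (A : Connection E 𝔸) : Prop :=
  Integrable (ymDensity A)

/-- The Yang–Mills action is nonnegative. Jaffe–Witten (2000) §1. [cite: JaffeWitten2000] -/
theorem ymAction_nonneg (A : Connection E 𝔸) : 0 ≤ ymAction A :=
  integral_nonneg fun x => ymDensity_nonneg A x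

/-- Gauge invariance of the Yang–Mills action, `S(g • A) = S(A)`, when `g` acts isometrically by
conjugation (e.g. unitary-valued `g` for a unitarily invariant norm on `𝔸`).
Jaffe–Witten (2000) §1 ("the Yang–Mills action is gauge invariant"). [cite: JaffeWitten2000] -/
def ymAction_gaugeAct : Prop :=
  ∀ [HasSummableGeomSeries 𝔸] (g : E → 𝔸ˣ) (A : Connection E 𝔸) (hg : ContDiff ℝ 2 fun y => (g y : 𝔸)) (hA : Differentiable ℝ A) (hiso : ∀ (x : E) (a : 𝔸), ‖(g x : 𝔸) * a * ((g x)⁻¹ : 𝔸ˣ)‖ = ‖a‖),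
    ymAction (gaugeAct g A) = ymAction A

/- interim proof relied on results that are now named facts (D-0014); demoted to a fact by the M5 import, proof preserved:
:= by
  simp [ymAction, ymDensity_gaugeAct g A hg hA hiso]
-/

end General

end Literature.MathematicalPhysics.QuantumLattice

/-! ### A Frobenius-norm fact (dot-notation extension of Mathlib's `Matrix` namespace) -/

namespace Matrix

open scoped Matrix.Norms.Frobenius

/-- The Frobenius (Hilbert–Schmidt) norm on `M_N(ℂ)` is invariant under conjugation by unitary
matrices: `‖U a U⁻¹‖ = ‖a‖`. Standard (`tr ((UaU*)* (UaU*)) = tr (a* a)`); Mathlib has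
`Matrix.frobenius_norm_conjTranspose` and `Matrix.frobenius_nnnorm_mul` but not this.
Placed in `namespace Matrix` deliberately (pure matrix fact). Horn–Johnson, *Matrix Analysis*
(2nd ed.), §5.6, unitary invariance of the Frobenius norm. [cite: HornJohnson2013, §5.6 (unitary invariance of the Frobenius norm)] -/
def frobenius_norm_toUnits_mul_mul_inv : Prop :=
  ∀ {N : ℕ} (U : Matrix.unitaryGroup (Fin N) ℂ) (a : Matrix (Fin N) (Fin N) ℂ),
    ‖(Unitary.toUnits U : Matrix (Fin N) (Fin N) ℂ) * a *
        ((Unitary.toUnits U)⁻¹ : (Matrix (Fin N) (Fin N) ℂ)ˣ)‖ = ‖a‖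

end Matrix

namespace Literature.MathematicalPhysics.QuantumLattice

/-! ### The unitary matrix case (`𝔸 = M_N(ℂ)`, Frobenius norm) -/

section MatrixGauge

open scoped Matrix.Norms.Frobenius

variable {E : Type*} [NormedAddCommGroup E] [InnerProductSpace ℝ E] [FiniteDimensional ℝ E]
variable {N : ℕ}

/-- When the norm on the coefficients comes from a conjugation-compatible inner product (here the
Frobenius norm on `M_N(ℂ)`), the Yang–Mills density `∑_{i<j} ‖F_A(x)(bᵢ,bⱼ)‖²` does not depend
on the orthonormal frame `b`: it is half the squared Hilbert–Schmidt norm of the antisymmetric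
bilinear map `F_A(x)`. Differentiability of `A` at `x` is needed: otherwise the junk values of
`fderiv` make `curvature A x` non-bilinear and the sum genuinely depends on the frame.
Jaffe–Witten (2000) §1 (invariant quadratic form). [cite: JaffeWitten2000] -/
def ymDensity_eq_of_orthonormalBasis : Prop :=
  ∀ {ι : Type*} [Fintype ι] [LinearOrder ι] (b : OrthonormalBasis ι ℝ E) (A : Connection E (Matrix (Fin N) (Fin N) ℂ)) (x : E) (hA : DifferentiableAt ℝ A x),
    ymDensity A x = ymDensityOfBasis b A x

variable [MeasurableSpace E] [BorelSpace E]

/-- Gauge invariance of the Yang–Mills action for `U(N)`-valued gauge transformations and the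
Frobenius norm on `M_N(ℂ)`: `S(g • A) = S(A)`. Jaffe–Witten (2000) §1. [cite: JaffeWitten2000] -/
def ymAction_gaugeAct_unitaryGroup : Prop :=
  ∀ (g : E → Matrix.unitaryGroup (Fin N) ℂ) (A : Connection E (Matrix (Fin N) (Fin N) ℂ)) (hg : ContDiff ℝ 2 fun y => (g y : Matrix (Fin N) (Fin N) ℂ)) (hA : Differentiable ℝ A),
    ymAction (gaugeAct (fun x => Unitary.toUnits (g x)) A) = ymAction A

/- interim proof relied on results that are now named facts (D-0014); demoted to a fact by the M5 import, proof preserved: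
:=
  ymAction_gaugeAct _ A hg hA fun x a => Matrix.frobenius_norm_toUnits_mul_mul_inv (g x) a
-/

end MatrixGauge

end Literature.MathematicalPhysics.QuantumLattice

/-! ### Discharge of `Matrix.frobenius_norm_toUnits_mul_mul_inv`

Unitary invariance of the Frobenius norm: Horn–Johnson, *Matrix Analysis* (2nd ed., 2013),
§2.2, Theorem 2.2.2 (p. 94): for unitary `U ∈ M_n`, `V ∈ M_m` and `A = U B V` one has
`∑ᵢⱼ |bᵢⱼ|² = ∑ᵢⱼ |aᵢⱼ|²`, "in particular if `m = n` and `V = U*`". The printed proof is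
`tr A*A = tr (UBV)*(UBV) = tr V*B*U*UBV = tr V*B*BV = tr B*BVV* = tr B*B` together with
`tr A*A = ∑ |aᵢⱼ|²` (0.2.5). We follow it: `‖A‖² = Re tr (Aᴴ A)`
(`Matrix.frobenius_norm_sq_eq_re_trace`), left invariance from `U*U = I`, right invariance by
passing to the conjugate transpose. The vendored fact is the "in particular" clause. -/

namespace Matrix

open scoped Matrix.Norms.Frobenius

section FrobeniusUnitary

variable {m n 𝕜 : Type*} [Fintype m] [Fintype n] [RCLike 𝕜]

/-- The squared Frobenius norm is the (real part of the) trace of `Aᴴ A`: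
`‖A‖₂² = ∑ᵢⱼ |aᵢⱼ|² = tr A*A`. Horn–Johnson (2013), (0.2.5) and the proof of Theorem 2.2.2;
§5.6 (the Frobenius / `l₂` norm). [cite: HornJohnson2013, (0.2.5); Thm 2.2.2 (proof)] -/
theorem frobenius_norm_sq_eq_re_trace (A : Matrix m n 𝕜) :
    ‖A‖ ^ 2 = RCLike.re (trace (Aᴴ * A)) := by
  rw [frobenius_norm_def, ← Real.sqrt_eq_rpow,
    Real.sq_sqrt (Finset.sum_nonneg fun i _ => Finset.sum_nonneg fun j _ => by positivity)]
  simp only [Matrix.trace, Matrix.diag, Matrix.mul_apply, conjTranspose_apply, RCLike.star_def,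
    RCLike.conj_mul, map_sum, Real.rpow_two]
  rw [Finset.sum_comm]
  simp

/-- Left unitary invariance of the Frobenius norm: `‖U A‖₂ = ‖A‖₂` for unitary `U`.
Horn–Johnson (2013), Theorem 2.2.2 (case `V = I`); §5.6. [cite: HornJohnson2013, Thm 2.2.2] -/
theorem frobenius_norm_unitaryGroup_mul [DecidableEq m] (U : unitaryGroup m 𝕜)
    (A : Matrix m n 𝕜) : ‖(U : Matrix m m 𝕜) * A‖ = ‖A‖ := by
  have hU : (U : Matrix m m 𝕜)ᴴ * (U : Matrix m m 𝕜) = 1 := UnitaryGroup.star_mul_self U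
  have h : ‖(U : Matrix m m 𝕜) * A‖ ^ 2 = ‖A‖ ^ 2 := by
    rw [frobenius_norm_sq_eq_re_trace, frobenius_norm_sq_eq_re_trace, conjTranspose_mul,
      Matrix.mul_assoc, ← Matrix.mul_assoc _ (U : Matrix m m 𝕜) A, hU, Matrix.one_mul]
  exact (sq_eq_sq₀ (norm_nonneg _) (norm_nonneg _)).mp h

/-- Right unitary invariance of the Frobenius norm: `‖A U‖₂ = ‖A‖₂` for unitary `U`.
Horn–Johnson (2013), Theorem 2.2.2 (case `U = I`); §5.6. [cite: HornJohnson2013, Thm 2.2.2] -/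
theorem frobenius_norm_mul_unitaryGroup [DecidableEq n] (A : Matrix m n 𝕜)
    (U : unitaryGroup n 𝕜) : ‖A * (U : Matrix n n 𝕜)‖ = ‖A‖ := by
  rw [← frobenius_norm_conjTranspose, conjTranspose_mul]
  have : (U : Matrix n n 𝕜)ᴴ = ((U⁻¹ : unitaryGroup n 𝕜) : Matrix n n 𝕜) := rfl
  rw [this, frobenius_norm_unitaryGroup_mul, frobenius_norm_conjTranspose]

end FrobeniusUnitary

/-- Discharge of the named fact `Matrix.frobenius_norm_toUnits_mul_mul_inv`: the Frobenius norm on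
`M_N(ℂ)` is invariant under unitary conjugation, `‖U a U⁻¹‖ = ‖a‖` (`U⁻¹ = U*`). Horn–Johnson
(2013), §2.2, Theorem 2.2.2, "in particular" clause (unitary similarity `A = U B U*` preserves
`∑ |aᵢⱼ|²`, i.e. the squared Frobenius norm of §5.6). [cite: HornJohnson2013, Thm 2.2.2] -/
theorem frobenius_norm_toUnits_mul_mul_inv_holds : frobenius_norm_toUnits_mul_mul_inv := by
  intro N U a
  rw [Unitary.val_toUnits_apply, Unitary.val_inv_toUnits_apply, frobenius_norm_mul_unitaryGroup,
    frobenius_norm_unitaryGroup_mul]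

end Matrix
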